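import Summits.Ventures.PercRepro.Night2LocalRuleLossFair

/-!
# PercRepro — counting the targets of a loss (night-2, gen 18)

The skeleton of every cell proof under the fair-share loss routing (`Night2LocalRuleLossFair`):

* every set between `B ∪ {z}` and `G` is a shadow set with closure `G` (`superset_mem_shadowAt`), so the
  targets of the loss of `B` at `z` are exactly the sets `B ∪ {z} ∪ X` with `∅ ≠ X ⊆ G ∖ (B ∪ {z})`
  (`tgtSets_eq_image`), `2^{|G ∖ (B ∪ {z})|} − 1` of them (`card_tgtSets`);
* **`lossIncome_ge_of_bounds`**: if on every target `S` the loss mass is at most `u |S|` and the residual capacity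
  at least `v |S| ≥ 0` (functions of the size only), then
  `lossIncome B z ≥ Σ_{j=1}^{r} C(r, j) · v (b + j) / u (b + j)` with `r = |G ∖ (B ∪ {z})|`, `b = |B ∪ {z}|`
  (`Finset.sum_powerset_apply_card` groups the targets by the size of `X`).
So a cell is closed by exhibiting `u`, `v` from its structure and proving the resulting explicit inequality —
for the rigid cell `(q−1, q−2)` it is `rigid_ineq` (`Night2RigidIneq`, paper §7).
-/

namespace PercRepro.Shadow

open Finset PerFlat ThmH

variable {α : Type*} [DecidableEq α] {M : Matroid α} [M.Finite]

/-! ## Supersets of a covering set are shadow sets -/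

open scoped Classical in
/-- A set between `B ∪ {z}` and `G` (`B` a member inside `G`, `z ∈ G ∖ cl B`) is a shadow set with closure `G`. -/
theorem superset_mem_shadowAt {q : ℕ} {G : Finset α} (hG : G ∈ flatsQ M (q + 1)) {B : Finset α}
    (hB : B ∈ membersIn M (Uq M (q + 2) q) G) {z : α} (hz : z ∈ G \ clF M B) {S : Finset α}
    (hBS : insert z B ⊆ S) (hSG : S ⊆ G) : S ∈ shadowAt M (q + 2) q (Uq M (q + 2) q) G := by
  have hBU : B ∈ Uq M (q + 2) q := (mem_membersIn.1 hB).1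
  have hGg : G ⊆ gr M := (mem_flatsQ.1 hG).1
  have hGr : M.eRk (G : Set α) = ((q + 1 : ℕ) : ℕ∞) := (mem_flatsQ.1 hG).2.2
  have hY : insert z B ∈ Yq M (q + 2) q :=
    insert_mem_Yq hBU (hGg (Finset.mem_sdiff.1 hz).1) (Finset.mem_sdiff.1 hz).2
  have hr1 : M.eRk ((insert z B : Finset α) : Set α) = ((q + 1 : ℕ) : ℕ∞) := eRk_eq_of_mem_Yq_diag hY
  have hrS : M.eRk (S : Set α) = ((q + 1 : ℕ) : ℕ∞) := by
    apply le_antisymm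
    · rw [← hGr]; exact M.eRk_mono (by exact_mod_cast hSG)
    · rw [← hr1]; exact M.eRk_mono (by exact_mod_cast hBS)
  have hSY : S ∈ Yq M (q + 2) q := by
    unfold Yq
    rw [Finset.mem_filter, Finset.mem_powerset, hrS]
    refine ⟨hSG.trans hGg, ?_, ?_⟩
    · exact_mod_cast (by omega : q < q + 1)
    · exact_mod_cast (by omega : q + 1 < q + 2)
  rw [mem_shadowAt, mem_shadow]
  refine ⟨⟨hSY, B, hBU, (Finset.subset_insert z B).trans hBS⟩, ?_⟩
  have hsub : clF M S ⊆ G := by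
    rw [← Finset.coe_subset, coe_clF]
    exact (M.closure_subset_closure (by exact_mod_cast hSG)).trans (mem_flatsQ.1 hG).2.1.closure.subset
  exact flat_eq_of_subset_of_eRk_eq hG (by rw [coe_clF]; exact M.isFlat_closure _) hsub
    (by rw [coe_clF, M.eRk_closure_eq]; exact hrS)

open scoped Classical in
/-- A shadow set with closure `G` lies in `G`. -/
theorem subset_G_of_mem_shadowAt {q : ℕ} {G S : Finset α}
    (hS : S ∈ shadowAt M (q + 2) q (Uq M (q + 2) q) G) : S ⊆ G := by
  rw [mem_shadowAt, mem_shadow] at hS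
  obtain ⟨⟨hY, -⟩, hcl⟩ := hS
  have hSg : S ⊆ gr M := by
    unfold Yq at hY
    rw [Finset.mem_filter, Finset.mem_powerset] at hY
    exact hY.1
  rw [← hcl]
  exact subset_clF_of_subset_gr hSg

/-! ## The targets as a Boolean interval -/

open scoped Classical in
/-- The targets of the loss of `B` at `z` are the sets `B ∪ {z} ∪ X`, `∅ ≠ X ⊆ G ∖ (B ∪ {z})`. -/
theorem tgtSets_eq_image {q : ℕ} {G : Finset α} (hG : G ∈ flatsQ M (q + 1)) {B : Finset α}
    (hB : B ∈ membersIn M (Uq M (q + 2) q) G) {z : α} (hz : z ∈ G \ clF M B) :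
    tgtSets M q G B z =
      ((G \ insert z B).powerset.filter (fun X => X.Nonempty)).image (fun X => insert z B ∪ X) := by
  have hBU : B ∈ Uq M (q + 2) q := (mem_membersIn.1 hB).1
  have hzB : z ∉ B := notMem_of_notMem_clF hBU (Finset.mem_sdiff.1 hz).2
  ext S
  rw [mem_tgtSets, Finset.mem_image]
  constructor
  · rintro ⟨hS, hBS, hcard⟩
    have hSG : S ⊆ G := subset_G_of_mem_shadowAt hS
    refine ⟨S \ insert z B, ?_, ?_⟩
    · rw [Finset.mem_filter, Finset.mem_powerset]
      refine ⟨Finset.sdiff_subset_sdiff hSG (Finset.Subset.refl _), ?_⟩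
      -- |S ∖ B| ≥ 2 and S ∖ B ⊇ {z}: S ∖ (B ∪ {z}) is nonempty
      rw [Finset.nonempty_iff_ne_empty]
      intro hemp
      have h1 : S ⊆ insert z B := by
        intro x hx
        by_contra hxB
        have : x ∈ S \ insert z B := Finset.mem_sdiff.2 ⟨hx, hxB⟩
        rw [hemp] at this
        exact Finset.notMem_empty _ this
      have h2 : S = insert z B := le_antisymm h1 hBS
      rw [h2, Finset.insert_sdiff_of_notMem _ hzB, Finset.sdiff_self, Finset.insert_empty,
        Finset.card_singleton] at hcard
      omega
    · rw [Finset.union_sdiff_self_eq_union, Finset.union_eq_right.2 hBS]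
  · rintro ⟨X, hX, rfl⟩
    rw [Finset.mem_filter, Finset.mem_powerset] at hX
    obtain ⟨hXG, hXne⟩ := hX
    have hdisj : Disjoint X (insert z B) := Finset.disjoint_of_subset_left hXG Finset.sdiff_disjoint
    have hSG : insert z B ∪ X ⊆ G := by
      apply Finset.union_subset
      · exact Finset.insert_subset (Finset.mem_sdiff.1 hz).1 ((subset_clF hBU).trans (mem_membersIn.1 hB).2)
      · exact hXG.trans Finset.sdiff_subset
    refine ⟨superset_mem_shadowAt hG hB hz Finset.subset_union_left hSG, Finset.subset_union_left, ?_⟩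
    -- S ∖ B ⊇ {z} ∪ X with z ∉ X: at least 2 elements
    obtain ⟨x, hxX⟩ := hXne
    have hxz : x ≠ z := by
      intro h; rw [h] at hxX
      exact (Finset.mem_sdiff.1 (hXG hxX)).2 (Finset.mem_insert_self _ _)
    have hxB : x ∉ B := fun h => (Finset.mem_sdiff.1 (hXG hxX)).2 (Finset.mem_insert_of_mem h)
    have hpair : ({z, x} : Finset α) ⊆ (insert z B ∪ X) \ B := by
      intro y hy
      rw [Finset.mem_insert, Finset.mem_singleton] at hy
      rw [Finset.mem_sdiff, Finset.mem_union, Finset.mem_insert]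
      rcases hy with rfl | rfl
      · exact ⟨Or.inl (Or.inl rfl), hzB⟩
      · exact ⟨Or.inr hxX, hxB⟩
    have h2 : ({z, x} : Finset α).card = 2 := Finset.card_pair (Ne.symm hxz)
    calc 2 = ({z, x} : Finset α).card := h2.symm
      _ ≤ ((insert z B ∪ X) \ B).card := Finset.card_le_card hpair

open scoped Classical in
/-- The map `X ↦ B ∪ {z} ∪ X` is injective on the subsets of `G ∖ (B ∪ {z})`. -/
theorem union_injOn_sdiff {B : Finset α} {z : α} {G : Finset α} :
    Set.InjOn (fun X => insert z B ∪ X) (((G \ insert z B).powerset.filter (fun X => X.Nonempty)) : Set (Finset α)) := by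
  intro X hX X' hX' h
  rw [Finset.mem_coe, Finset.mem_filter, Finset.mem_powerset] at hX hX'
  have h1 : (insert z B ∪ X) \ insert z B = X :=
    by rw [Finset.union_sdiff_left, Finset.sdiff_eq_self_of_disjoint (Finset.disjoint_of_subset_left hX.1 Finset.sdiff_disjoint)]
  have h2 : (insert z B ∪ X') \ insert z B = X' :=
    by rw [Finset.union_sdiff_left, Finset.sdiff_eq_self_of_disjoint (Finset.disjoint_of_subset_left hX'.1 Finset.sdiff_disjoint)]
  have h3 : insert z B ∪ X = insert z B ∪ X' := h
  rw [← h1, ← h2, h3]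

open scoped Classical in
/-- The number of targets is `2^{|G ∖ (B ∪ {z})|} − 1`. -/
theorem card_tgtSets {q : ℕ} {G : Finset α} (hG : G ∈ flatsQ M (q + 1)) {B : Finset α}
    (hB : B ∈ membersIn M (Uq M (q + 2) q) G) {z : α} (hz : z ∈ G \ clF M B) :
    (tgtSets M q G B z).card = 2 ^ (G \ insert z B).card - 1 := by
  rw [tgtSets_eq_image hG hB hz, Finset.card_image_of_injOn union_injOn_sdiff]
  have h : (G \ insert z B).powerset.filter (fun X => X.Nonempty) = (G \ insert z B).powerset.erase ∅ := by
    ext X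
    rw [Finset.mem_filter, Finset.mem_erase, Finset.nonempty_iff_ne_empty]
    tauto
  rw [h, Finset.card_erase_of_mem (Finset.empty_mem_powerset _), Finset.card_powerset]

/-! ## The income from size-bounds -/

open scoped Classical in
/-- A sum over the targets of a function of the size, grouped by the size of `X`. -/
theorem sum_tgtSets_apply_card {q : ℕ} {G : Finset α} (hG : G ∈ flatsQ M (q + 1)) {B : Finset α}
    (hB : B ∈ membersIn M (Uq M (q + 2) q) G) {z : α} (hz : z ∈ G \ clF M B) (f : ℕ → ℚ) :
    ∑ S ∈ tgtSets M q G B z, f S.card =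
      ∑ j ∈ Finset.Icc 1 (G \ insert z B).card,
        ((G \ insert z B).card.choose j : ℚ) * f ((insert z B).card + j) := by
  have hBU : B ∈ Uq M (q + 2) q := (mem_membersIn.1 hB).1
  rw [tgtSets_eq_image hG hB hz, Finset.sum_image union_injOn_sdiff]
  -- |B ∪ {z} ∪ X| = |B ∪ {z}| + |X| for X disjoint from B ∪ {z}
  have hcard : ∀ X ∈ (G \ insert z B).powerset.filter (fun X => X.Nonempty),
      f (insert z B ∪ X).card = f ((insert z B).card + X.card) := by
    intro X hX
    rw [Finset.mem_filter, Finset.mem_powerset] at hX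
    rw [Finset.card_union_of_disjoint (Finset.disjoint_of_subset_right hX.1 Finset.sdiff_disjoint.symm)]
  rw [Finset.sum_congr rfl hcard]
  set R := G \ insert z B with hR
  set b := (insert z B).card with hb
  have hsplit : (R.powerset.filter (fun X => X.Nonempty)) = R.powerset.erase ∅ := by
    ext X
    rw [Finset.mem_filter, Finset.mem_erase, Finset.nonempty_iff_ne_empty]
    tauto
  rw [hsplit, Finset.sum_erase_eq_sub (Finset.empty_mem_powerset _)]
  rw [Finset.sum_powerset_apply_card (fun m => f (b + m)) (x := R)]
  simp only [Finset.card_empty, add_zero, nsmul_eq_mul]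
  -- split the range sum at m = 0
  rw [Finset.range_eq_Ico, Finset.sum_eq_sum_Ico_succ_bot (by omega : 0 < R.card + 1)]
  simp only [Nat.choose_zero_right, Nat.cast_one, one_mul, add_zero]
  rw [add_sub_cancel_left]
  apply Finset.sum_congr
  · ext j; simp only [Finset.mem_Ico, Finset.mem_Icc]; omega
  · intro j _; rfl

open scoped Classical in
/-- The loss weight of `(B, z)` is part of the mass of each of its targets. -/
theorem rhoL_le_pi2Mass {q : ℕ} {G : Finset α} (hG : G ∈ flatsQ M (q + 1)) (hd : (gr M \ G).card ≤ q)
    {B : Finset α} (hB : B ∈ thinMembers M q G) {z : α} (hz : z ∈ G \ clF M B) {S : Finset α}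
    (hS : S ∈ tgtSets M q G B z) : rhoL M q G B z ≤ pi2Mass M q G S := by
  unfold pi2Mass
  have hterm : ∀ B' ∈ thinMembers M q G, 0 ≤ ∑ z' ∈ G \ clF M B',
      (if S ∈ tgtSets M q G B' z' then rhoL M q G B' z' else 0) := by
    intro B' _
    apply Finset.sum_nonneg; intro z' _
    split_ifs
    · exact rhoL_nonneg hG hd B' z'
    · exact le_refl _
  refine le_trans ?_ (Finset.single_le_sum hterm hB)
  have hinner : ∀ z' ∈ G \ clF M B, 0 ≤ (if S ∈ tgtSets M q G B z' then rhoL M q G B z' else 0) := by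
    intro z' _
    split_ifs
    · exact rhoL_nonneg hG hd B z'
    · exact le_refl _
  refine le_trans ?_ (Finset.single_le_sum hinner hz)
  rw [if_pos hS]

open scoped Classical in
/-- **The income from size-bounds.**  If the loss of `B` at `z` is positive and on every target `S` the loss
mass is at most `u |S|` and the residual capacity at least `v |S| ≥ 0`, then
`lossIncome B z ≥ Σ_{j=1}^{r} C(r, j) · v (b + j) / u (b + j)`, `r = |G ∖ (B ∪ {z})|`, `b = |B ∪ {z}|`. -/
theorem lossIncome_ge_of_bounds {q : ℕ} {G : Finset α} (hG : G ∈ flatsQ M (q + 1))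
    (hd : (gr M \ G).card ≤ q) {B : Finset α} (hB : B ∈ thinMembers M q G) {z : α}
    (hz : z ∈ G \ clF M B) (hl : loss M q G B z ≠ 0) (u v : ℕ → ℚ)
    (hu : ∀ S ∈ tgtSets M q G B z, pi2Mass M q G S ≤ u S.card)
    (hv : ∀ S ∈ tgtSets M q G B z, v S.card ≤ cap2 M q G S)
    (hv0 : ∀ S ∈ tgtSets M q G B z, 0 ≤ v S.card) :
    ∑ j ∈ Finset.Icc 1 (G \ insert z B).card,
        ((G \ insert z B).card.choose j : ℚ) * (v ((insert z B).card + j) / u ((insert z B).card + j)) ≤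
      lossIncome M q G B z := by
  have hB' : B ∈ membersIn M (Uq M (q + 2) q) G := (mem_thinMembers.1 hB).1
  have hρ : 0 < rhoL M q G B z := by
    have h0 := rhoL_nonneg hG hd B z
    rcases h0.lt_or_eq with h | h
    · exact h
    · exfalso
      unfold rhoL at h
      have hl' : 0 < loss M q G B z := lt_of_le_of_ne (loss_nonneg' hG hd B z) (Ne.symm hl)
      have hT : (0 : ℚ) < ((tgtSets M q G B z).card : ℚ) := by
        rw [card_tgtSets hG hB' hz]
        have h2 : 1 ≤ (G \ insert z B).card := by
          -- G ∖ (B ∪ {z}) has ≥ 1 element since m ≥ 2 for a thin member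
          have hm := two_le_card_sdiff_of_not_lay0 hG hd hB' (mem_thinMembers.1 hB).2
          have hsub : (G \ clF M B).erase z ⊆ G \ insert z B := by
            intro x hx
            rw [Finset.mem_erase, Finset.mem_sdiff] at hx
            rw [Finset.mem_sdiff, Finset.mem_insert]
            exact ⟨hx.2.1, fun h => h.elim hx.1 (fun h' => hx.2.2 (subset_clF (mem_membersIn.1 hB').1 h'))⟩
          have := Finset.card_le_card hsub
          rw [Finset.card_erase_of_mem hz] at this
          omega
        have : (1 : ℕ) ≤ 2 ^ (G \ insert z B).card - 1 := by
          have : 2 ≤ 2 ^ (G \ insert z B).card := by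
            calc 2 = 2 ^ 1 := by norm_num
              _ ≤ 2 ^ (G \ insert z B).card := Nat.pow_le_pow_right (by norm_num) (by omega)
          omega
        exact_mod_cast (by omega : 0 < 2 ^ (G \ insert z B).card - 1)
      rw [eq_comm, div_eq_zero_iff] at h
      rcases h with h | h
      · exact hl h
      · linarith
  rw [← sum_tgtSets_apply_card hG hB' hz (fun s => v s / u s)]
  unfold lossIncome
  apply Finset.sum_le_sum
  intro S hS
  have hPi : 0 < pi2Mass M q G S := lt_of_lt_of_le hρ (rhoL_le_pi2Mass hG hd hB hz hS)
  calc v S.card / u S.card ≤ v S.card / pi2Mass M q G S :=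
        div_le_div_of_nonneg_left (hv0 S hS) hPi (hu S hS)
    _ ≤ cap2 M q G S / pi2Mass M q G S := div_le_div_of_nonneg_right (hv S hS) hPi.le

end PercRepro.Shadow
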